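import Literature.NumberTheory.IwasawaTheory.ClassicalMuVanishesQuadraticAscent
import Literature.NumberTheory.NumberFields.UnitSignatureSurjective
import HarnessLib

/-!
# Iwasawa's `μ₂ = 0` ascends a quadratic extension `K'/K` over `ℚ` when `K` has at most ONE real embedding and `K'` is totally complex
# (the unit-signature hypothesis of `ClassicalMuVanishesQuadraticAscent` discharged by the units of `ℚ_n`; proved, no definition, no named fact)

`Proofs`-style file (theorems only) in topic `NumberTheory/IwasawaTheory` (namespace `Literature.NumberTheory.IwasawaTheory`), written by the
prover seat `cruxlead-stmt-BirchSwinnertonDyer-19573-w2` GEN 7 (cell `bsd-2adic`; `--supports` stmt-BirchSwinnertonDyer-19573). Module (E-a) of the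
seat's «Iwasawa ℓ = 2 ascent with real places».

For `F = ℚ` and the cyclotomic `ℤ₂`-extension (layers `ℚ_n = ℚ(ζ_{2^{n+2}})⁺`), the layers of the restricted tower of a number field `K` are
`A_n = j(K)·ℚ_n`. If `K` has AT MOST ONE real embedding (e.g. a complex cubic field `ℚ(P)`, `Δ < 0`), two real embeddings of `A_n` that agree
on `ℚ_n` agree on `j(K)` (there is only one real embedding of `K`) and hence on `A_n` (`ringHom_ext_of_sup`); so the real embeddings of `A_n`
restrict injectively to those of `ℚ_n`, whose units take every signature (Weber; `UnitSignature.signVec_surjective_layer_rat_two`), and the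
signature map of `A_n` is onto (`UnitSignature.signVec_surjective_of_comp_injective`). Feeding this into
`classicalMuVanishes_restrict_of_quadratic_of_signVec_surjective` gives:

* **`classicalMuVanishes_restrict_rat_of_quadratic_of_subsingleton_realEmbedding`** — `κ` cyclotomic over `ℚ`, `K ⊆ K'` number fields,
  `[K' : K] = 2`, `K'` totally complex, `K` with at most one real embedding, `κ ∘ res` onto for both, at most `T` primes of `A_n` ramified in
  `B_n = j'(K')·ℚ_n` for every `n`: `ClassicalMuVanishes (κ|_K) ⟹ ClassicalMuVanishes (κ|_{K'})`.

References: [Iwasawa1973MuInvariants] Thm. 2/3, §4; [Washington1997] Thm. 10.4, §13.1, §13.3 Prop. 13.23; [FrohlichTaylor1990] Ch. V §1 (1.12).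
-/

set_option autoImplicit false

noncomputable section

open scoped NumberField Classical
open NumberField Field IntermediateField IsDedekindDomain

namespace Literature.NumberTheory.IwasawaTheory

open Literature.NumberTheory.EllipticCurves Literature.NumberTheory.EllipticCurves.ZpExtension
  Literature.NumberTheory.GaloisRepresentations Literature.NumberTheory.NumberFields
  Literature.NumberTheory.NumberFields.UnitSignature Literature.Geometry.Kaehler.ComplexTorus

/-! ## §1 Ring homomorphisms out of a compositum `E ⊔ L` are determined on `E` and on `L` -/

/-- **Two ring homomorphisms `↥(E ⊔ L) → R` that agree on `E` and on `L` are equal** (`E, L` intermediate fields of `M/F`, `R` a field):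
the equaliser is an intermediate field containing `E` and `L`. [folklore] [cite: Washington1997, §13.1 (the compositum K·ℚ_n)] -/
theorem ringHom_ext_of_sup {F M : Type*} [Field F] [Field M] [Algebra F M] {R : Type*} [Field R]
    (E L : IntermediateField F M) (ρ₁ ρ₂ : ↥(E ⊔ L) →+* R)
    (hE : ∀ (x : M) (hx : x ∈ E), ρ₁ ⟨x, (le_sup_left : E ≤ E ⊔ L) hx⟩ = ρ₂ ⟨x, (le_sup_left : E ≤ E ⊔ L) hx⟩)
    (hL : ∀ (x : M) (hx : x ∈ L), ρ₁ ⟨x, (le_sup_right : L ≤ E ⊔ L) hx⟩ = ρ₂ ⟨x, (le_sup_right : L ≤ E ⊔ L) hx⟩) :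
    ρ₁ = ρ₂ := by
  -- the equaliser, as an intermediate field of `M/F` inside `E ⊔ L`
  let S : IntermediateField F M :=
    { carrier := {x | ∃ hx : x ∈ E ⊔ L, ρ₁ ⟨x, hx⟩ = ρ₂ ⟨x, hx⟩}
      mul_mem' := by
        rintro a b ⟨ha, ha'⟩ ⟨hb, hb'⟩
        refine ⟨mul_mem ha hb, ?_⟩
        have e : (⟨a * b, mul_mem ha hb⟩ : ↥(E ⊔ L)) = ⟨a, ha⟩ * ⟨b, hb⟩ := rfl
        rw [e, map_mul, map_mul, ha', hb']
      one_mem' := ⟨one_mem _, by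
        have e : (⟨1, one_mem _⟩ : ↥(E ⊔ L)) = 1 := rfl
        rw [e, map_one, map_one]⟩
      add_mem' := by
        rintro a b ⟨ha, ha'⟩ ⟨hb, hb'⟩
        refine ⟨add_mem ha hb, ?_⟩
        have e : (⟨a + b, add_mem ha hb⟩ : ↥(E ⊔ L)) = ⟨a, ha⟩ + ⟨b, hb⟩ := rfl
        rw [e, map_add, map_add, ha', hb']
      zero_mem' := ⟨zero_mem _, by
        have e : (⟨0, zero_mem _⟩ : ↥(E ⊔ L)) = 0 := rfl
        rw [e, map_zero, map_zero]⟩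
      algebraMap_mem' := fun r ↦ ⟨IntermediateField.algebraMap_mem _ r, by
        have hr : algebraMap F M r ∈ E := IntermediateField.algebraMap_mem E r
        exact hE _ hr⟩
      inv_mem' := by
        rintro a ⟨ha, ha'⟩
        refine ⟨inv_mem ha, ?_⟩
        have e : (⟨a⁻¹, inv_mem ha⟩ : ↥(E ⊔ L)) = (⟨a, ha⟩ : ↥(E ⊔ L))⁻¹ := rfl
        rw [e, map_inv₀, map_inv₀, ha'] }
  have hES : E ≤ S := fun x hx ↦ ⟨(le_sup_left : E ≤ E ⊔ L) hx, hE x hx⟩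
  have hLS : L ≤ S := fun x hx ↦ ⟨(le_sup_right : L ≤ E ⊔ L) hx, hL x hx⟩
  have hle : E ⊔ L ≤ S := sup_le hES hLS
  ext ⟨x, hx⟩
  obtain ⟨hx', h⟩ := hle hx
  exact h

/-! ## §2 Real embeddings of `j(K)·ℚ_n` and the signature hypothesis -/

variable (κ : ZpExtension ℚ 2)

/-- **Real embeddings of `A = j(K) ⊔ L` restrict injectively to `L` when `K` has at most one real embedding**: two real embeddings of `A`
agreeing on `L` agree on `j(K) ≅ K` (a unique real embedding) and then on `A` (`ringHom_ext_of_sup`).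
[cite: FrohlichTaylor1990, Ch. V §1 (real embeddings), p. 163] -/
theorem comp_algebraMap_injective_of_subsingleton_realEmbedding (K : Type) [Field K] [Algebra ℚ K]
    [Subsingleton (K →+* ℝ)] (j : K →ₐ[ℚ] AlgebraicClosure ℚ) (L : IntermediateField ℚ (AlgebraicClosure ℚ)) :
    letI : Algebra ↥L ↥(j.fieldRange ⊔ L) := (IntermediateField.inclusion (le_sup_right : L ≤ j.fieldRange ⊔ L)).toRingHom.toAlgebra
    Function.Injective fun ρ : ↥(j.fieldRange ⊔ L) →+* ℝ ↦ ρ.comp (algebraMap ↥L ↥(j.fieldRange ⊔ L)) := by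
  intro ρ₁ ρ₂ h
  refine ringHom_ext_of_sup j.fieldRange L ρ₁ ρ₂ (fun x hx ↦ ?_) (fun x hx ↦ ?_)
  · -- on `j(K)`: two real embeddings of `K` coincide
    obtain ⟨y, rfl⟩ := hx
    have hmem : ∀ z : K, (j z : AlgebraicClosure ℚ) ∈ j.fieldRange ⊔ L :=
      fun z ↦ (le_sup_left : j.fieldRange ≤ j.fieldRange ⊔ L) ⟨z, rfl⟩
    let ι : K →+* ↥(j.fieldRange ⊔ L) :=
      { toFun := fun z ↦ ⟨j z, hmem z⟩
        map_one' := Subtype.ext (map_one j)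
        map_mul' := fun a b ↦ Subtype.ext (map_mul j a b)
        map_zero' := Subtype.ext (map_zero j)
        map_add' := fun a b ↦ Subtype.ext (map_add j a b) }
    have heq : ρ₁.comp ι = ρ₂.comp ι := Subsingleton.elim _ _
    exact RingHom.congr_fun heq y
  · have := RingHom.congr_fun h ⟨x, hx⟩
    exact this

/-- **The unit signature map of `j(K)·ℚ_n` is onto** when `K` has at most one real embedding (`κ` the cyclotomic `ℤ₂`-extension of `ℚ`,
`ℚ_n` its `n`-th layer): units of `ℚ_n` of every signature (Weber; `UnitSignature.signVec_surjective_layer_rat_two`) pushed up along the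
injective restriction of real embeddings. [cite: Washington1997, Thm. 10.4 and §13.1] [cite: FrohlichTaylor1990, Ch. V §1 (1.12), p. 164] -/
theorem signVec_surjective_fieldRange_sup_layer (hκ : κ.IsCyclotomic) (K : Type) [Field K] [NumberField K]
    [Subsingleton (K →+* ℝ)] (j : K →ₐ[ℚ] AlgebraicClosure ℚ) (n : ℕ) :
    (haveI : NumberField ↥(j.fieldRange ⊔ κ.layer n) := numberField_fieldRange_sup_layer κ K j n
     Function.Surjective (signVec (K := ↥(j.fieldRange ⊔ κ.layer n)))) := by
  haveI : Fact (Nat.Prime 2) := ⟨Nat.prime_two⟩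
  haveI : NumberField ↥(j.fieldRange ⊔ κ.layer n) := numberField_fieldRange_sup_layer κ K j n
  haveI : FiniteDimensional ℚ ↥(κ.layer n) := κ.finiteDimensional_layer_holds n
  haveI : NumberField ↥(κ.layer n) := NumberField.of_module_finite ℚ _
  letI : Algebra ↥(κ.layer n) ↥(j.fieldRange ⊔ κ.layer n) :=
    (IntermediateField.inclusion (le_sup_right : κ.layer n ≤ j.fieldRange ⊔ κ.layer n)).toRingHom.toAlgebra
  exact signVec_surjective_of_comp_injective (comp_algebraMap_injective_of_subsingleton_realEmbedding K j (κ.layer n))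
    (signVec_surjective_layer_rat_two κ hκ n)

/-! ## §3 The ascent over `ℚ` -/

/-- **Iwasawa's `μ₂ = 0` ascends a quadratic extension over `ℚ` with at most one real embedding downstairs and none upstairs.** `κ` the
cyclotomic `ℤ₂`-extension of `ℚ`; `K ⊆ K'` number fields, `[K' : K] = 2`, `K'` totally complex, `K` with at most one real embedding,
`κ ∘ res` onto for `K` and `K'` (`K' ∩ ℚ_∞ = ℚ`), `j' : K' → ℚ̄`, and at most `T` primes of `A_n = j'(K)·ℚ_n` ramified in `B_n = j'(K')·ℚ_n` for
every `n`. Then `ClassicalMuVanishes (κ|_K) ⟹ ClassicalMuVanishes (κ|_{K'})` — `ClassicalMuVanishesQuadraticAscent` with its signature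
hypothesis discharged by §2. [cite: Iwasawa1973MuInvariants, Thm. 2 and Thm. 3, §4] [cite: Washington1997, §13.3 Prop. 13.23] -/
theorem classicalMuVanishes_restrict_rat_of_quadratic_of_subsingleton_realEmbedding (hκ : κ.IsCyclotomic)
    (K K' : Type) [Field K] [NumberField K] [Field K'] [NumberField K'] [Algebra K K'] [IsTotallyComplex K']
    [Subsingleton (K →+* ℝ)] (hdeg : Module.finrank K K' = 2)
    (hK : Function.Surjective (κ.toContinuousMonoidHom.comp (absGaloisRestrict ℚ K)))
    (hK' : Function.Surjective (κ.toContinuousMonoidHom.comp (absGaloisRestrict ℚ K')))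
    (j' : K' →ₐ[ℚ] AlgebraicClosure ℚ) (T : ℕ)
    (hram : ∀ n : ℕ,
      letI : Algebra ↥((j'.comp (IsScalarTower.toAlgHom ℚ K K')).fieldRange ⊔ κ.layer n) ↥(j'.fieldRange ⊔ κ.layer n) :=
        (IntermediateField.inclusion (fieldRange_comp_sup_layer_le κ K K' j' n)).toRingHom.toAlgebra
      {v : HeightOneSpectrum (𝓞 ↥((j'.comp (IsScalarTower.toAlgHom ℚ K K')).fieldRange ⊔ κ.layer n)) |
        v.asIdeal.ramificationIdxIn (𝓞 ↥(j'.fieldRange ⊔ κ.layer n)) ≠ 1}.ncard ≤ T)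
    (hμ : ClassicalMuVanishes (κ.restrict K hK)) :
    ClassicalMuVanishes (κ.restrict K' hK') :=
  classicalMuVanishes_restrict_of_quadratic_of_signVec_surjective κ K K' hdeg hK hK' j' T hram
    (fun n ↦ signVec_surjective_fieldRange_sup_layer κ hκ K (j'.comp (IsScalarTower.toAlgHom ℚ K K')) n) hμ

end Literature.NumberTheory.IwasawaTheory

end
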